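import Literature.NumberTheory.EllipticCurves.BSDSelmerSmithHigherSelmerRankLaws
import Literature.NumberTheory.EllipticCurves.BSDSelmerSmithCaseIICoefficientsProofs
import Literature.NumberTheory.EllipticCurves.Kriz2020.CongruentNumberDensityOneProofs
import HarnessLib

/-!
# Smith JAMS I Thm. 1.5 / JAMS II Thm. 1.4: where each law applies (Case I vs. Case II), and the
# congruent number family — proofs only

A `…Proofs` companion (theorems only; no definitions, no named facts) of
`BSDSelmerSmithHigherSelmerRankLaws` (A. Smith, J. Amer. Math. Soc. 39 (2026) 1–72 [Smi22a],
Thm. 1.5; 453–514 [Smi22b], Thm. 1.4):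

* `smi22aAssumptionOneOrThree_iff_smithCaseI` — "case (1) or (3) of Assumption 1.1" is EXACTLY
  Case I of A. Smith, arXiv:2503.17619, Def. 1.6 ("no cyclic degree `4` isogeny" = "no balanced
  isogeny" for full rational `2`-torsion, tree `forall_not_isBalanced_iff_forall_not_isCyclic`);
  `smi22aAssumptionOneOrThree_iff` — equivalently Assumption 1.1 with `#A(ℚ)[2] ≠ 2`.
* `not_smi22aAssumptionOneOrThree_of_not_isSquare` — the curves `y² = x(x² + ax + b)` of [Smi22b]
  Example 1.2 / Thm. 1.4 (three non-square conditions) are in Case II (`smithCaseII_of_not_isSquare`),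
  so Thm. 1.5 does NOT apply to them: Thm. 1.4 is the complementary law.
* `smi22aAssumptionOneOrThree_congruentNumberCurve` — every congruent number curve
  `E_n : y² = x³ − n²x` is in case (3) (tree `smithCaseI_congruentNumberCurve`: `E_n(ℚ)[2] ≅ (ℤ/2ℤ)²`,
  no balanced isogeny), hence **Thm. 1.5 gives the full `2^k`-Selmer Markov law for the quadratic
  twists of `E_n` from REFEREED print** (`twoPowerSelmerRanks_markov_congruentNumberCurve`; the
  `r_2`-layer is Heath-Brown 1994 / Kane 2013, cited in [Smi22a] §1.3.1).

## References

* [Smith2022SelmerTwistI] A. Smith, J. Amer. Math. Soc. 39 (2026) 1–72 = arXiv:2207.05674v2: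
  Assumption 1.1, Thm. 1.5, §1.3.1 ("Heath-Brown … congruent number curve … generalized … by Kane").
* [Smith2026SelmerTwistII] A. Smith, J. Amer. Math. Soc. 39 (2026) 453–514 = arXiv:2207.05143v2:
  Example 1.2, Thm. 1.4; §3.1 Example 3.1 (eq. (3.1): the cyclic-`4`-isogeny criterion).
* [arXiv250317619] A. Smith, arXiv:2503.17619, Def. 1.6 (Cases I, II).
-/

noncomputable section

open scoped Classical
open Filter Topology

namespace Literature.NumberTheory.EllipticCurves

open WeierstrassCurve

/-- **Cases (1)/(3) of Assumption 1.1 = Case I of arXiv:2503.17619, Def. 1.6** (for an elliptic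
curve over `ℚ`): with `#E(ℚ)[2] = 4`, "no cyclic degree-`4` isogeny over `ℚ`" ⟺ "no balanced
isogeny" (`forall_not_isBalanced_iff_forall_not_isCyclic`).
[cite: Smith2022SelmerTwistI, Assumption 1.1 (1), (3)] [cite: arXiv250317619, Def. 1.6] -/
theorem smi22aAssumptionOneOrThree_iff_smithCaseI (W : WeierstrassCurve ℚ) [W.IsElliptic] :
    smi22aAssumptionOneOrThree W ↔ smithCaseI W := by
  unfold smi22aAssumptionOneOrThree smithCaseI
  refine or_congr Iff.rfl ⟨?_, ?_⟩
  · rintro ⟨h4, h⟩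
    exact ⟨h4, (forall_not_isBalanced_iff_forall_not_isCyclic W h4).mpr h⟩
  · rintro ⟨h4, h⟩
    exact ⟨h4, (forall_not_isBalanced_iff_forall_not_isCyclic W h4).mp h⟩

/-- Cases (1)/(3) = Assumption 1.1 together with `#A(ℚ)[2] ≠ 2` (branch (2) is the one with
`A(ℚ)[2] ≅ ℤ/2ℤ`). [cite: Smith2022SelmerTwistI, Assumption 1.1] -/
theorem smi22aAssumptionOneOrThree_iff (W : WeierstrassCurve ℚ) :
    smi22aAssumptionOneOrThree W ↔ smi22aAssumption W ∧ ratTwoTorsionCard W ≠ 2 := by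
  unfold smi22aAssumptionOneOrThree smi22aAssumption
  constructor
  · rintro (h1 | ⟨h4, h⟩)
    · exact ⟨Or.inl h1, by omega⟩
    · exact ⟨Or.inr (Or.inr ⟨h4, h⟩), by omega⟩
  · rintro ⟨h1 | ⟨h2, -⟩ | ⟨h4, h⟩, hne⟩
    · exact Or.inl h1
    · exact absurd h2 hne
    · exact Or.inr ⟨h4, h⟩

/-- **The curves of [Smi22b] Thm. 1.4 are outside the scope of [Smi22a] Thm. 1.5**: for rational
`a, b` with `a² − 4b`, `b`, `b(a² − 4b)` non-squares, `A : y² = x(x² + ax + b)` is in Case II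
(`smithCaseII_of_not_isSquare`), so `#A(ℚ)[2] = 2` and cases (1)/(3) fail.
[cite: Smith2026SelmerTwistII, Example 1.2 and Thm. 1.4] [cite: Smith2022SelmerTwistI, Rem. 1.6] -/
theorem not_smi22aAssumptionOneOrThree_of_not_isSquare {a b : ℚ} (h1 : ¬ IsSquare (a ^ 2 - 4 * b))
    (h2 : ¬ IsSquare b) (h3 : ¬ IsSquare (b * (a ^ 2 - 4 * b))) :
    ¬ smi22aAssumptionOneOrThree (⟨0, a, 0, b, 0⟩ : WeierstrassCurve ℚ) := by
  have hII := smithCaseII_of_not_isSquare a b h1 h2 h3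
  rw [smi22aAssumptionOneOrThree_iff]
  rintro ⟨-, hne⟩
  exact hne hII.1

/-- **Every congruent number curve `E_n : y² = x³ − n²x` (`n ≠ 0`) is in case (3) of
Assumption 1.1** (`E_n(ℚ)[2] ≅ (ℤ/2ℤ)²`, no cyclic `4`-isogeny over `ℚ`; tree
`smithCaseI_congruentNumberCurve`; [Smi22b] Example 3.1: for `x(x − 1)(x + 1)` the three products of
eq. (3.1) are `−1, 2, 2`, none a rational square). [cite: Smith2022SelmerTwistI, Assumption 1.1 (3)]
[cite: Smith2026SelmerTwistII, §3.1 Example 3.1 (eq. (3.1))] -/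
theorem smi22aAssumptionOneOrThree_congruentNumberCurve {n : ℕ} (hn : n ≠ 0) :
    smi22aAssumptionOneOrThree (congruentNumberCurve n) := by
  haveI := isElliptic_congruentNumberCurve hn
  exact (smi22aAssumptionOneOrThree_iff_smithCaseI _).mpr (smithCaseI_congruentNumberCurve hn)

/-- **The `2^k`-Selmer ranks in the congruent number family form Smith's Markov chain, from
REFEREED print**: [Smi22a] Thm. 1.5 (hypothesis `h`, the named fact
`smith2026_twoPowerSelmerRanks_markov`) applied to `E_n : y² = x³ − n²x`, `n ≠ 0`, which is in case
(3) (`smi22aAssumptionOneOrThree_congruentNumberCurve`): for every nonincreasing `(r_{2^k})_{k ≥ 1}`,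
`#{d ≠ 0 : |d| < H, r_{2^k}(E_n^d) = r_{2^k} ∀ k ≥ 1} / 2H → P^Alt(r_2 | ∞) ∏_{k ≥ 2} P^Alt(r_{2^k} | r_{2^{k-1}})`
(limits named by the `Tendsto` hypotheses as in the fact; `E_n^d = (congruentNumberCurve n).quadraticTwist d`).
[cite: Smith2022SelmerTwistI, Thm. 1.5 with Assumption 1.1 (3)] -/
theorem twoPowerSelmerRanks_markov_congruentNumberCurve (h : smith2026_twoPowerSelmerRanks_markov)
    {n : ℕ} (hn : n ≠ 0) (r : ℕ → ℕ) (hr : ∀ k, 1 ≤ k → r (k + 1) ≤ r k) (P₁ Pprod : ℝ)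
    (hP₁ : Tendsto (fun m : ℕ ↦ (probKerDimAlt (2 * m) (r 1) + probKerDimAlt (2 * m + 1) (r 1)) / 2)
      atTop (𝓝 P₁))
    (hPprod : Tendsto (fun m : ℕ ↦ ∏ k ∈ Finset.Ico 2 m, probKerDimAlt (r (k - 1)) (r k))
      atTop (𝓝 Pprod)) :
    Tendsto (fun H : ℕ ↦
      (Nat.card {d : ℤ | d ≠ 0 ∧ |d| < (H : ℤ) ∧
          ∀ k, 1 ≤ k → twistSelmerTorsionRankPow (congruentNumberCurve n) k d = r k} : ℝ) / (2 * H))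
      atTop (𝓝 (P₁ * Pprod)) := by
  haveI := isElliptic_congruentNumberCurve hn
  exact h (congruentNumberCurve n) (smi22aAssumptionOneOrThree_congruentNumberCurve hn) r hr P₁ Pprod
    hP₁ hPprod

end Literature.NumberTheory.EllipticCurves

end
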